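import Summits.CriticalPhenomena.Ising3DConformalLimit.Theses.FKParityRobustness
import Literature.Probability.LatticeModels.GKSInequalities
import Literature.Probability.LatticeModels.PlusFreeComparison
import Summits.CriticalPhenomena.Ising3DConformalLimit.Theorems.FKParityRobustnessDefs
import Summits.CriticalPhenomena.Ising3DConformalLimit.Theorems.FKParityRobustnessShadowGivesJoin

/-!
# `StrandShadow` (item stmt-CriticalPhenomena-14626): the junk in the depleted free correlation

Standing crux disprover (refuter-cdisprove-stmt-CriticalPhenomena-14626-0), cycle 1 — NEGATIVE-SIDE
SUPPORT LEMMAS (no Theses decl is concluded positively).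

The crux averages `isingCorr G Λ_F β_c 0 .free {a₂, a₃}` over strand configurations `F`, with the
depleted volume `Λ_F = {v | ¬ a₀ ↝_F v}`.  The free finite-volume correlation freezes the spins
OUTSIDE the volume to `+1` (`BoundaryCondition.outside free = 1`), so `⟨σ_A⟩^free_Λ = ⟨σ_{A ∩ Λ}⟩^free_Λ`
(`isingCorr_free_eq_inter`, meanwhile landed in `Theorems/FKParityRobustnessShadowGivesJoin.lean` and
reused from there): when the `a₀`-cluster of `F` swallows both `a₂` and `a₃` the summand is
the junk value `t^|F| · 1` (`depletedCorr_eq_one_of_swallowed`; intended: `0`), and `0` when it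
swallows exactly one (`depletedCorr_eq_zero_of_one_swallowed`).  Hence the exact decomposition
`LHS_formal = LHS_clean + J` with `J = Σ_{F : a₂,a₃ swallowed} t^|F| ≥ 0` (`lhs_decomposition`,
`junk_nonneg`), and the formal crux IMPLIES its junk-free repair C′ (`strandShadow_imp_clean`), the
statement the informal text ("couplings at `V(K)` switched off") intends.  USAGE NOTE: the crux body
carries classical `Finset.filter` instances (an elaboration accident of the Theses file) while the generic
lemmas below carry constructive ones — transport them to the crux with `convert … using k`, never
`exact`/`rw` (the defeq check would unfold `Finset.univ` of the box and time out).  Quantitatively (MC job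
j013016 of this seat) `J/(Z·G₂₃) ≈ 0.04` at `l = 1` against a clean margin `≈ 0.3`, decaying like
`l^{-3/2}`: the misstatement is real but does not falsify the crux at small `l`.
-/

noncomputable section

namespace Summit.CriticalPhenomena.Ising3DConformalLimit.StrandShadowNegative

open scoped BigOperators Classical
open Finset
open Literature.Probability.LatticeModels
open Summit.CriticalPhenomena.Ising3DConformalLimit.Theses.FKParityRobustness (StrandShadow)

/-! ## The free finite-volume correlation ignores the sites outside the volume -/

section Junk

variable {V : Type*} (G : SimpleGraph V) [DecidableEq V] [G.LocallyFinite]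

/-- `⟨σ_∅⟩ = 1`. [folklore] -/
theorem isingCorr_free_empty (Λ : Finset V) (β h : ℝ) : isingCorr G Λ β h .free ∅ = 1 := by
  rw [isingCorr, isingExpect, integral_isingMeasure G Λ β h .free (measurable_spinProduct ∅)]
  simp only [spinProduct, Finset.prod_empty, mul_one]
  exact div_self (isingPartitionFunction_pos G Λ β h .free).ne'

/-- If `A` misses the volume entirely, the "correlation" is the junk value `1`. [folklore] -/
theorem isingCorr_free_eq_one_of_disjoint (Λ : Finset V) (β h : ℝ) {A : Finset V}
    (hA : Disjoint A Λ) : isingCorr G Λ β h .free A = 1 := by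
  rw [Summit.CriticalPhenomena.Ising3DConformalLimit.Theorems.isingCorr_free_eq_inter, Finset.disjoint_iff_inter_eq_empty.1 hA, isingCorr_free_empty]

/-- One site in, one site out, zero field: the pair "correlation" is `⟨σ_y⟩^free_{Λ;β,0} = 0`. [folklore] -/
theorem isingCorr_free_pair_eq_zero (Λ : Finset V) (β : ℝ) {x y : V} (hx : x ∉ Λ) (hy : y ∈ Λ) :
    isingCorr G Λ β 0 .free {x, y} = 0 := by
  rw [Summit.CriticalPhenomena.Ising3DConformalLimit.Theorems.isingCorr_free_eq_inter]
  have hxy : ({x, y} : Finset V) ∩ Λ = {y} := by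
    ext z
    simp only [Finset.mem_inter, Finset.mem_insert, Finset.mem_singleton]
    constructor
    · rintro ⟨hz | hz, hzΛ⟩
      · exact absurd hzΛ (hz ▸ hx)
      · exact hz
    · intro hz
      exact ⟨Or.inr hz, hz ▸ hy⟩
  rw [hxy]
  exact isingCorr_free_of_odd_card_holds G Λ β (Finset.singleton_subset_iff.2 hy) (by simp)

end Junk

/-! ### The junk inside the crux summand -/

section Summand

variable {V : Type*} [Fintype V] [DecidableEq V] (G : SimpleGraph V) [DecidableRel G.Adj]

/-- When the `a₀`-cluster of `F` swallows both `a₂` and `a₃`, the crux's depleted "correlation"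
is the junk value `1` (intended value: `0`). [folklore] -/
theorem depletedCorr_eq_one_of_swallowed (F : Finset (Sym2 V)) (β h : ℝ) {a₀ a₂ a₃ : V}
    (h2 : (SimpleGraph.fromEdgeSet (↑F : Set (Sym2 V))).Reachable a₀ a₂)
    (h3 : (SimpleGraph.fromEdgeSet (↑F : Set (Sym2 V))).Reachable a₀ a₃) :
    isingCorr G (Finset.univ.filter fun v : V => ¬ (SimpleGraph.fromEdgeSet (↑F : Set (Sym2 V))).Reachable a₀ v) β h .free {a₂, a₃} = 1 := by
  apply isingCorr_free_eq_one_of_disjoint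
  rw [Finset.disjoint_left]
  intro z hz
  simp only [Finset.mem_insert, Finset.mem_singleton] at hz
  simp only [Finset.mem_filter, Finset.mem_univ, true_and, not_not]
  rcases hz with rfl | rfl <;> assumption

/-- When the `a₀`-cluster swallows exactly one of `a₂, a₃` (zero field) the depleted correlation
is `0` — here the junk and the intended value agree. [folklore] -/
theorem depletedCorr_eq_zero_of_one_swallowed (F : Finset (Sym2 V)) (β : ℝ) {a₀ a₂ a₃ : V}
    (h2 : (SimpleGraph.fromEdgeSet (↑F : Set (Sym2 V))).Reachable a₀ a₂)
    (h3 : ¬ (SimpleGraph.fromEdgeSet (↑F : Set (Sym2 V))).Reachable a₀ a₃) :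
    isingCorr G (Finset.univ.filter fun v : V => ¬ (SimpleGraph.fromEdgeSet (↑F : Set (Sym2 V))).Reachable a₀ v) β 0 .free {a₂, a₃} = 0 := by
  apply isingCorr_free_pair_eq_zero
  · simp [h2]
  · simp [h3]

/-- Symmetric version of `depletedCorr_eq_zero_of_one_swallowed`. [folklore] -/
theorem depletedCorr_eq_zero_of_one_swallowed' (F : Finset (Sym2 V)) (β : ℝ) {a₀ a₂ a₃ : V}
    (h2 : ¬ (SimpleGraph.fromEdgeSet (↑F : Set (Sym2 V))).Reachable a₀ a₂)
    (h3 : (SimpleGraph.fromEdgeSet (↑F : Set (Sym2 V))).Reachable a₀ a₃) :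
    isingCorr G (Finset.univ.filter fun v : V => ¬ (SimpleGraph.fromEdgeSet (↑F : Set (Sym2 V))).Reachable a₀ v) β 0 .free {a₂, a₃} = 0 := by
  rw [Finset.pair_comm]
  exact depletedCorr_eq_zero_of_one_swallowed G F β h3 h2

/-- **LHS decomposition.** For any family `𝒯` of configurations, zero field and `t`:
`Σ_{F ∈ 𝒯} t^|F| ⟨σ₂σ₃⟩_{depl F} = Σ_{F ∈ 𝒯, clean} t^|F| ⟨σ₂σ₃⟩_{depl F} + Σ_{F ∈ 𝒯, both swallowed} t^|F|`,
"clean" = neither `a₂` nor `a₃` swallowed.  The second sum is the JUNK term `J ≥ 0`. [folklore] -/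
theorem lhs_decomposition (𝒯 : Finset (Finset (Sym2 V))) (t β : ℝ) (a₀ a₂ a₃ : V) :
    (∑ F ∈ 𝒯, t ^ F.card * isingCorr G (Finset.univ.filter fun v : V => ¬ (SimpleGraph.fromEdgeSet (↑F : Set (Sym2 V))).Reachable a₀ v) β 0 .free {a₂, a₃}) =
      (∑ F ∈ 𝒯.filter (fun F : Finset (Sym2 V) => ¬ (SimpleGraph.fromEdgeSet (↑F : Set (Sym2 V))).Reachable a₀ a₂ ∧
          ¬ (SimpleGraph.fromEdgeSet (↑F : Set (Sym2 V))).Reachable a₀ a₃),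
        t ^ F.card * isingCorr G (Finset.univ.filter fun v : V => ¬ (SimpleGraph.fromEdgeSet (↑F : Set (Sym2 V))).Reachable a₀ v) β 0 .free {a₂, a₃}) +
      ∑ F ∈ 𝒯.filter (fun F : Finset (Sym2 V) => (SimpleGraph.fromEdgeSet (↑F : Set (Sym2 V))).Reachable a₀ a₂ ∧
          (SimpleGraph.fromEdgeSet (↑F : Set (Sym2 V))).Reachable a₀ a₃), t ^ F.card := by
  set R : Finset (Sym2 V) → V → Prop := fun F v =>
    (SimpleGraph.fromEdgeSet (↑F : Set (Sym2 V))).Reachable a₀ v with hR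
  set f : Finset (Sym2 V) → ℝ := fun F => t ^ F.card * isingCorr G (Finset.univ.filter fun v : V => ¬ (SimpleGraph.fromEdgeSet (↑F : Set (Sym2 V))).Reachable a₀ v) β 0 .free {a₂, a₃}
    with hf
  -- split 𝒯 into clean / not clean
  rw [← Finset.sum_filter_add_sum_filter_not 𝒯 (fun F => ¬ R F a₂ ∧ ¬ R F a₃) f]
  congr 1
  -- on the complement: either both swallowed (summand = t^|F|) or exactly one (summand = 0)
  rw [← Finset.sum_filter_add_sum_filter_not (𝒯.filter fun F => ¬(¬ R F a₂ ∧ ¬ R F a₃))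
    (fun F => R F a₂ ∧ R F a₃) f]
  have hboth : (𝒯.filter fun F => ¬(¬ R F a₂ ∧ ¬ R F a₃)).filter (fun F => R F a₂ ∧ R F a₃) =
      𝒯.filter (fun F => R F a₂ ∧ R F a₃) := by
    ext F; simp only [Finset.mem_filter]; tauto
  have hzero : ∑ F ∈ (𝒯.filter fun F => ¬(¬ R F a₂ ∧ ¬ R F a₃)).filter (fun F => ¬ (R F a₂ ∧ R F a₃)),
      f F = 0 := by
    refine Finset.sum_eq_zero fun F hF => ?_
    simp only [Finset.mem_filter] at hF
    obtain ⟨⟨_, hF1⟩, hF2⟩ := hF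
    by_cases h2 : R F a₂
    · have h3 : ¬ R F a₃ := fun h3 => hF2 ⟨h2, h3⟩
      simp only [hf, hR] at h2 h3 ⊢
      rw [depletedCorr_eq_zero_of_one_swallowed G F β h2 h3, mul_zero]
    · have h3 : R F a₃ := by
        by_contra h3; exact hF1 ⟨h2, h3⟩
      simp only [hf, hR] at h2 h3 ⊢
      rw [depletedCorr_eq_zero_of_one_swallowed' G F β h2 h3, mul_zero]
  rw [hzero, add_zero, hboth]
  refine Finset.sum_congr rfl fun F hF => ?_
  simp only [Finset.mem_filter] at hF
  simp only [hf]
  rw [depletedCorr_eq_one_of_swallowed G F β 0 hF.2.1 hF.2.2, mul_one]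

/-- The junk term is nonnegative for `t ≥ 0`, so dropping it only LOWERS the left side. [folklore] -/
theorem junk_nonneg (𝒯 : Finset (Finset (Sym2 V))) {t : ℝ} (ht : 0 ≤ t) (a₀ a₂ a₃ : V) :
    0 ≤ ∑ F ∈ 𝒯.filter (fun F : Finset (Sym2 V) => (SimpleGraph.fromEdgeSet (↑F : Set (Sym2 V))).Reachable a₀ a₂ ∧
          (SimpleGraph.fromEdgeSet (↑F : Set (Sym2 V))).Reachable a₀ a₃), t ^ F.card :=
  Finset.sum_nonneg fun _ _ => pow_nonneg ht _

/-- `lhs_decomposition` with the `Finset.filter` instances PINNED to the shape the crux body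
elaborates to in the Theses file (inner volume filter: `instDecidableNot ∘ Classical.propDecidable`;
outer filters: `Classical.propDecidable`), so that it rewrites the `StrandShadow` body and chains
with the `StrandShadowClean` (C′) body by `rw`, without instance transport. [folklore] -/
theorem lhs_decomposition_pinned (𝒯 : Finset (Finset (Sym2 V))) (t β : ℝ) (a₀ a₂ a₃ : V) :
    (∑ F ∈ 𝒯, t ^ F.card * isingCorr G (@Finset.filter V
        (fun v => ¬ (SimpleGraph.fromEdgeSet (↑F : Set (Sym2 V))).Reachable a₀ v)
        (fun _ => @instDecidableNot _ (Classical.propDecidable _)) Finset.univ) β 0 .free {a₂, a₃}) =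
      (∑ F ∈ @Finset.filter (Finset (Sym2 V)) (fun F : Finset (Sym2 V) =>
          ¬ (SimpleGraph.fromEdgeSet (↑F : Set (Sym2 V))).Reachable a₀ a₂ ∧
          ¬ (SimpleGraph.fromEdgeSet (↑F : Set (Sym2 V))).Reachable a₀ a₃)
          (fun _ => Classical.propDecidable _) 𝒯,
        t ^ F.card * isingCorr G (@Finset.filter V
          (fun v => ¬ (SimpleGraph.fromEdgeSet (↑F : Set (Sym2 V))).Reachable a₀ v)
          (fun _ => @instDecidableNot _ (Classical.propDecidable _)) Finset.univ) β 0 .free {a₂, a₃}) +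
      ∑ F ∈ @Finset.filter (Finset (Sym2 V)) (fun F : Finset (Sym2 V) =>
          (SimpleGraph.fromEdgeSet (↑F : Set (Sym2 V))).Reachable a₀ a₂ ∧
          (SimpleGraph.fromEdgeSet (↑F : Set (Sym2 V))).Reachable a₀ a₃)
          (fun _ => Classical.propDecidable _) 𝒯, t ^ F.card := by
  have hvol : ∀ F : Finset (Sym2 V), (@Finset.filter V
      (fun v => ¬ (SimpleGraph.fromEdgeSet (↑F : Set (Sym2 V))).Reachable a₀ v)
      (fun _ => @instDecidableNot _ (Classical.propDecidable _)) Finset.univ) =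
      (Finset.univ.filter fun v : V => ¬ (SimpleGraph.fromEdgeSet (↑F : Set (Sym2 V))).Reachable a₀ v) := by
    intro F; ext v; simp [Finset.mem_filter]
  simp only [hvol]
  convert lhs_decomposition G 𝒯 t β a₀ a₂ a₃ using 4

end Summand

/-! ## The formal crux implies the intended (junk-free) one -/


/-- **`StrandShadow` implies its junk-free repair C′** (the sum restricted to the configurations
whose `a₀`-cluster swallows neither `a₂` nor `a₃`; for the others the INTENDED depleted
correlation is `0`, whereas the formal summand is `t^|F|·1` when both are swallowed).  The formal
crux is therefore the STRONGER statement; the repair C′ (inlined conclusion below) is what the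
informal text means. [folklore] -/
theorem strandShadow_imp_clean : StrandShadow →
    (let tetra : Fin 4 → Site 3 := ![![-1, -1, -1], ![1, 1, -1], ![1, -1, 1], ![-1, 1, 1]]
     ∃ c : ℝ, 0 < c ∧ ∀ l : ℕ, 1 ≤ l → ∃ N₀ : ℕ, ∀ N : ℕ, N₀ ≤ N → ∀ a : Fin 4 → ↥(box 3 N),
      (∀ i, ((a i : Site 3)) = (l : ℤ) • tetra i) →
      (let G := (zdGraph 3).comap (Subtype.val : ↥(box 3 N) → Site 3)
       let β : ℝ := criticalBeta 3
       let t : ℝ := Real.tanh β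
       (∑ F ∈ (tJoins G Set.univ {a 0, a 1}).filter (fun F : Finset (Sym2 ↥(box 3 N)) =>
            ¬ (SimpleGraph.fromEdgeSet (↑F : Set (Sym2 ↥(box 3 N)))).Reachable (a 0) (a 2) ∧
            ¬ (SimpleGraph.fromEdgeSet (↑F : Set (Sym2 ↥(box 3 N)))).Reachable (a 0) (a 3)),
          t ^ F.card * isingCorr G (Finset.univ.filter (fun v : ↥(box 3 N) =>
            ¬ (SimpleGraph.fromEdgeSet (↑F : Set (Sym2 ↥(box 3 N)))).Reachable (a 0) v)) β 0 .free {a 2, a 3})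
        ≤ (1 - c) * loopO1PartitionFunction G t {a 0, a 1} * isingCorr G Finset.univ β 0 .free {a 2, a 3})) := by
  rintro ⟨c, hc, h⟩
  refine ⟨c, hc, fun l hl => ?_⟩
  obtain ⟨N₀, hN⟩ := h l hl
  refine ⟨N₀, fun N hNN a ha => ?_⟩
  have key := hN N hNN a ha
  simp only at key ⊢
  refine le_trans ?_ key
  apply Finset.sum_le_sum_of_subset_of_nonneg (Finset.filter_subset _ _)
  intro F _ _
  refine mul_nonneg (pow_nonneg
    Summit.CriticalPhenomena.Ising3DConformalLimit.Cruxes.ParityRobustMerging.PlaquetteXorSurgery.tanh_criticalBeta_nonneg _) ?_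
  exact Summit.CriticalPhenomena.Ising3DConformalLimit.Theorems.isingCorr_free_nonneg _ _ (criticalBeta_nonneg 3) le_rfl _

end Summit.CriticalPhenomena.Ising3DConformalLimit.StrandShadowNegative

end
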